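import Literature.AlgebraicTopology.Homotopy.SimplexHat
import Literature.AlgebraicTopology.Homotopy.LinearActionSign
import Mathlib.LinearAlgebra.Matrix.SchurComplement
import Mathlib.GroupTheory.Perm.Sign
import HarnessLib

/-!
# Permuting the vertices of a based simplicial sphere multiplies its class by the sign

Topic `Literature/AlgebraicTopology/Homotopy`, continuing `SimplexHat.lean` (the class
`toClass (hat g hg) : π_ k X x₀` of a based simplicial sphere `g : Δᵏ → X`) and
`LinearActionSign.lean` (affine changes of coordinates act by the sign of the determinant).

* `mapCM σ`: the vertex permutation `stdSimplex.map σ` as a continuous self-map of `Δᵏ`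
  (`stdSimplex_map_equiv_apply : map σ s i = s (σ⁻¹ i)`), and `IsBased.comp_mapCM`;
* the transposition of two vertices `≠ 0` is, on the corner simplex, the coordinate swap — the
  product `negMatrix l' * transvection l l' 1 * transvection l' l (-1) * transvection l l' 1`
  (`swapMatrix_mulVec`), of determinant `-1`; the transposition of the vertex `0` with the vertex
  `l + 1` is the affine involution `y ↦ update y l (1 - ∑ yᵢ)` (`vswapAff l`), of determinant `-1`
  (Weinstein–Aronszajn / `det_one_add_replicateCol_mul_replicateRow`);
* `CSphere.toClass_hat_comp_swap`: transposing two vertices inverts the class;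
* `CSphere.toClass_hat_comp_mapCM`: **`toClass (hat (g ∘ σ)) = toClass (hat g) ^ sign σ`** for
  every permutation `σ` of the vertices (swap induction).

Everything is proved; `[folklore]` (Hatcher, *Algebraic Topology* (2002), §4.1, p. 341 and §2.1,
p. 105: reordering the vertices of a simplex changes orientation by the sign of the permutation).

## References

* A. Hatcher, *Algebraic Topology*, CUP (2002), §2.1 p. 105, §4.1 p. 341. [HatcherAT2002]
-/

noncomputable section

open Set Metric Topology Matrix Equiv
open scoped Topology.Homotopy

universe u

namespace Literature.AlgebraicTopology.Homotopy

variable {k : ℕ}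

/-! ### Vertex permutations of the standard simplex -/

/-- For a bijection, `stdSimplex.map` permutes the barycentric coordinates. [folklore] -/
theorem stdSimplex_map_equiv_apply {n : ℕ} (σ : Perm (Fin n)) (s : stdSimplex ℝ (Fin n)) (i : Fin n) :
    stdSimplex.map σ s i = s (σ.symm i) := by
  rw [stdSimplex.map_coe, FunOnFinite.linearMap_apply_apply]
  have h : (Finset.univ.filter fun x : Fin n => σ x = i) = {σ.symm i} := by
    ext x
    simp only [Finset.mem_filter, Finset.mem_univ, true_and, Finset.mem_singleton]
    constructor
    · intro hx; rw [← hx, Equiv.symm_apply_apply]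
    · intro hx; rw [hx, Equiv.apply_symm_apply]
  rw [h, Finset.sum_singleton]

/-- The vertex permutation as a continuous self-map of the standard simplex. [folklore] -/
def mapCM {n : ℕ} (σ : Perm (Fin n)) : C(stdSimplex ℝ (Fin n), stdSimplex ℝ (Fin n)) :=
  ⟨stdSimplex.map σ, stdSimplex.continuous_map σ⟩

/-- `mapCM σ` permutes the barycentric coordinates. [folklore] -/
@[simp] theorem mapCM_apply {n : ℕ} (σ : Perm (Fin n)) (s : stdSimplex ℝ (Fin n)) (i : Fin n) :
    mapCM σ s i = s (σ.symm i) :=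
  stdSimplex_map_equiv_apply σ s i

/-- `mapCM 1 = id`. [folklore] -/
theorem mapCM_one {n : ℕ} (s : stdSimplex ℝ (Fin n)) : mapCM (1 : Perm (Fin n)) s = s :=
  stdSimplex.ext (funext fun i => by rw [mapCM_apply]; rfl)

/-- `mapCM` is multiplicative (as an action on the simplex). [folklore] -/
theorem mapCM_mul {n : ℕ} (σ τ : Perm (Fin n)) (s : stdSimplex ℝ (Fin n)) :
    mapCM (σ * τ) s = mapCM σ (mapCM τ s) :=
  stdSimplex.ext (funext fun i => by simp [Perm.mul_def])

variable {X : Type u} [TopologicalSpace X] {x₀ : X}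

/-- Precomposing a based sphere with a vertex permutation gives a based sphere. [folklore] -/
theorem IsBased.comp_mapCM {g : C(stdSimplex ℝ (Fin (k + 1)), X)} (hg : IsBased x₀ g)
    (σ : Perm (Fin (k + 1))) : IsBased x₀ (g.comp (mapCM σ)) := by
  rintro s ⟨i, hi⟩
  exact hg _ ⟨σ i, by rw [mapCM_apply, Equiv.symm_apply_apply]; exact hi⟩

/-! ### Transposing two vertices other than `0`: a coordinate swap -/

section CoordSwap

variable (l l' : Fin k)

/-- The coordinate swap as a product of three transvections and one coordinate reversal.
[folklore] -/
def swapMatrix : Matrix (Fin k) (Fin k) ℝ :=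
  CSphere.negMatrix l' * transvection l l' 1 * transvection l' l (-1) * transvection l l' 1

/-- A transvection acting on a vector. [folklore] -/
theorem transvection_mulVec_apply (i j : Fin k) (c : ℝ) (y : Fin k → ℝ) (m : Fin k) :
    (transvection i j c *ᵥ y) m = y m + if m = i then c * y j else 0 := by
  rw [transvection, add_mulVec, one_mulVec, single_mulVec]
  simp only [Pi.add_apply, Function.update_apply, Pi.zero_apply]

variable {l l'}

/-- **The product is the coordinate swap.** [folklore] -/
theorem swapMatrix_mulVec (hll' : l ≠ l') (y : Fin k → ℝ) :
    swapMatrix l l' *ᵥ y = y ∘ Equiv.swap l l' := by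
  funext m
  simp only [swapMatrix, ← mulVec_mulVec, Function.comp_apply]
  rw [CSphere.negMatrix_mulVec, transvection_mulVec_apply, transvection_mulVec_apply,
    transvection_mulVec_apply]
  simp only [transvection_mulVec_apply, if_neg hll'.symm]
  by_cases hml : m = l
  · subst hml
    simp only [if_true, if_neg hll', Equiv.swap_apply_left]
    ring
  · by_cases hml' : m = l'
    · subst hml'
      simp only [if_true, if_neg hml, Equiv.swap_apply_right]
      ring
    · simp only [hml, hml', if_false, Equiv.swap_apply_of_ne_of_ne hml hml']
      ring

/-- `det (swapMatrix l l') = -1`. [folklore] -/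
theorem det_swapMatrix (hll' : l ≠ l') : (swapMatrix l l').det = -1 := by
  simp only [swapMatrix, det_mul, CSphere.det_negMatrix, det_transvection_of_ne _ _ hll',
    det_transvection_of_ne _ _ hll'.symm]
  norm_num

/-- Swapping two coordinates preserves the corner simplex. [folklore] -/
theorem comp_swap_mem_cornerSimplex_iff (y : Fin k → ℝ) :
    y ∘ Equiv.swap l l' ∈ cornerSimplex k ↔ y ∈ cornerSimplex k := by
  have hsum : ∀ z : Fin k → ℝ, ∑ i, (z ∘ Equiv.swap l l') i = ∑ i, z i := fun z =>
    Equiv.sum_comp (Equiv.swap l l') z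
  constructor
  · rintro ⟨h1, h2⟩
    refine ⟨fun i => ?_, by rwa [hsum] at h2⟩
    have := h1 (Equiv.swap l l' i)
    simpa [Function.comp_apply, Equiv.swap_apply_self] using this
  · rintro ⟨h1, h2⟩
    exact ⟨fun i => h1 _, by rwa [hsum]⟩

/-- Barycentric coordinates of the swapped point are the swapped barycentric coordinates.
[folklore] -/
theorem baryPt_comp_swap {y : Fin k → ℝ} (hy : y ∈ cornerSimplex k)
    (hy' : y ∘ Equiv.swap l l' ∈ cornerSimplex k) :
    baryPt (y ∘ Equiv.swap l l') hy' = mapCM (Equiv.swap l.succ l'.succ) (baryPt y hy) := by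
  apply stdSimplex.ext
  funext i
  rw [mapCM_apply, Equiv.symm_swap]
  refine Fin.cases ?_ (fun j => ?_) i
  · have h0 : Equiv.swap l.succ l'.succ 0 = 0 :=
      Equiv.swap_apply_of_ne_of_ne (Fin.succ_ne_zero l).symm (Fin.succ_ne_zero l').symm
    rw [h0]
    simp only [baryPt_apply, baryCoords_zero]
    rw [show (∑ i, (y ∘ Equiv.swap l l') i) = ∑ i, y i from Equiv.sum_comp (Equiv.swap l l') y]
  · have hs : Equiv.swap l.succ l'.succ j.succ = (Equiv.swap l l' j).succ := by
      rcases eq_or_ne j l with rfl | hjl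
      · rw [Equiv.swap_apply_left, Equiv.swap_apply_left]
      · rcases eq_or_ne j l' with rfl | hjl'
        · rw [Equiv.swap_apply_right, Equiv.swap_apply_right]
        · rw [Equiv.swap_apply_of_ne_of_ne hjl hjl', Equiv.swap_apply_of_ne_of_ne]
          · exact fun h => hjl (Fin.succ_injective _ h)
          · exact fun h => hjl' (Fin.succ_injective _ h)
    rw [hs]
    simp

end CoordSwap

/-! ### Transposing the vertex `0` with the vertex `l + 1`: an affine involution -/

section VSwap

variable (l : Fin k)

/-- The affine map `y ↦ update y l (1 - ∑ yᵢ)` exchanging the vertices `0` and `eₗ` of the corner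
simplex, as an `AffMap`: linear part `1 - eₗ (𝟙 + eₗ)ᵀ`, shift `eₗ`. [folklore] -/
def vswapAff : CSphere.AffMap k :=
  ⟨1 - vecMulVec (Pi.single l 1) (1 + Pi.single l 1), Pi.single l 1⟩

/-- `vswapAff l` is `y ↦ update y l (1 - ∑ yᵢ)`. [folklore] -/
theorem vswapAff_apply (y : Fin k → ℝ) : vswapAff l y = Function.update y l (1 - ∑ i, y i) := by
  funext m
  rw [CSphere.AffMap.apply_def, vswapAff]
  simp only [sub_mulVec, one_mulVec, vecMulVec_mulVec, Pi.add_apply, Pi.sub_apply, Pi.smul_apply,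
    Function.update_apply, MulOpposite.smul_eq_mul_unop, MulOpposite.unop_op, add_dotProduct,
    one_dotProduct, single_dotProduct, one_mul]
  by_cases hm : m = l
  · subst hm; simp; ring
  · simp [hm]

/-- `det (vswapAff l).lin = -1`. [folklore] -/
theorem det_vswapAff : (vswapAff l).lin.det = -1 := by
  have h : (vswapAff l).lin =
      1 + replicateCol (Fin 1) (-(Pi.single l (1 : ℝ))) *
        replicateRow (Fin 1) ((1 : Fin k → ℝ) + Pi.single l 1) := by
    ext i j
    simp only [vswapAff, Matrix.sub_apply, Matrix.add_apply, vecMulVec_apply, Matrix.mul_apply,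
      Matrix.replicateCol_apply, Matrix.replicateRow_apply, Finset.univ_unique, Finset.sum_singleton,
      Pi.add_apply, Pi.neg_apply, Pi.one_apply]
    ring
  rw [h]
  refine (det_one_add_replicateCol_mul_replicateRow _ _).trans ?_
  rw [add_dotProduct, one_dotProduct, single_dotProduct]
  simp

/-- `vswapAff l` preserves the corner simplex. [folklore] -/
theorem vswapAff_mem_cornerSimplex {y : Fin k → ℝ} (hy : y ∈ cornerSimplex k) :
    vswapAff l y ∈ cornerSimplex k := by
  rw [vswapAff_apply]
  refine ⟨fun i => ?_, ?_⟩
  · rw [Function.update_apply]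
    split_ifs
    · linarith [hy.2]
    · exact hy.1 i
  · rw [Finset.sum_update_of_mem (Finset.mem_univ l)]
    have : ∑ x ∈ Finset.univ \ {l}, y x = ∑ x, y x - y l := by
      rw [Finset.sum_sdiff_eq_sub (Finset.singleton_subset_iff.2 (Finset.mem_univ l)),
        Finset.sum_singleton]
    rw [this]
    linarith [hy.1 l]

/-- `vswapAff l` is an involution. [folklore] -/
theorem vswapAff_vswapAff (y : Fin k → ℝ) : vswapAff l (vswapAff l y) = y := by
  rw [vswapAff_apply, vswapAff_apply]
  funext m
  by_cases hm : m = l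
  · subst hm
    rw [Function.update_self, Finset.sum_update_of_mem (Finset.mem_univ m)]
    have : ∑ x ∈ Finset.univ \ {m}, y x = ∑ x, y x - y m := by
      rw [Finset.sum_sdiff_eq_sub (Finset.singleton_subset_iff.2 (Finset.mem_univ m)),
        Finset.sum_singleton]
    rw [this]; ring
  · rw [Function.update_of_ne hm, Function.update_of_ne hm]

/-- `vswapAff l` preserves the corner simplex exactly. [folklore] -/
theorem vswapAff_mem_cornerSimplex_iff (y : Fin k → ℝ) :
    vswapAff l y ∈ cornerSimplex k ↔ y ∈ cornerSimplex k :=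
  ⟨fun h => by simpa only [vswapAff_vswapAff] using vswapAff_mem_cornerSimplex l h,
    vswapAff_mem_cornerSimplex l⟩

/-- Barycentric coordinates after `vswapAff l`: the vertices `0` and `l + 1` are exchanged.
[folklore] -/
theorem baryPt_vswapAff {y : Fin k → ℝ} (hy : y ∈ cornerSimplex k) (hy' : vswapAff l y ∈ cornerSimplex k) :
    baryPt (vswapAff l y) hy' = mapCM (Equiv.swap 0 l.succ) (baryPt y hy) := by
  apply stdSimplex.ext
  funext i
  rw [mapCM_apply, Equiv.symm_swap]
  have hsum : ∑ i, vswapAff l y i = 1 - y l := by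
    rw [vswapAff_apply, Finset.sum_update_of_mem (Finset.mem_univ l),
      Finset.sum_sdiff_eq_sub (Finset.singleton_subset_iff.2 (Finset.mem_univ l)), Finset.sum_singleton]
    ring
  refine Fin.cases ?_ (fun j => ?_) i
  · rw [Equiv.swap_apply_left]
    simp only [baryPt_apply, baryCoords_zero, baryCoords_succ, hsum]
    ring
  · by_cases hj : j = l
    · subst hj
      rw [Equiv.swap_apply_right]
      simp only [baryPt_apply, baryCoords_succ, baryCoords_zero, vswapAff_apply, Function.update_self]
    · rw [Equiv.swap_apply_of_ne_of_ne (Fin.succ_ne_zero j) (fun h => hj (Fin.succ_injective _ h))]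
      simp only [baryPt_apply, baryCoords_succ, vswapAff_apply, Function.update_of_ne hj]

end VSwap

/-! ### The effect of a transposition, and of a general permutation, on the class -/

namespace CSphere

/-- `det (vswapAff l).lin ≠ 0`. [folklore] -/
theorem det_vswapAff_ne_zero (l : Fin k) : (vswapAff l).lin.det ≠ 0 := by
  rw [det_vswapAff]; norm_num

/-- **The hat of `g` with the vertices `0` and `l + 1` transposed is the hat of `g` precomposed with
the affine involution `vswapAff l`.** [folklore] -/
theorem hat_comp_mapCM_swap_zero (g : C(stdSimplex ℝ (Fin (k + 1)), X)) (hg : IsBased x₀ g) (l : Fin k) :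
    hat (g.comp (mapCM (Equiv.swap 0 l.succ))) (hg.comp_mapCM _) =
      precompAff (hat g hg) (vswapAff l) (det_vswapAff_ne_zero l) := by
  refine ext fun y => ?_
  rw [precompAff_apply]
  by_cases hy : y ∈ cornerSimplex k
  · have hy' := (vswapAff_mem_cornerSimplex_iff l y).2 hy
    rw [hat_apply_of_mem _ _ hy, hat_apply_of_mem _ _ hy', ContinuousMap.comp_apply,
      baryPt_vswapAff l hy hy']
  · rw [hat_apply_of_not_mem _ _ hy,
      hat_apply_of_not_mem _ _ (fun h => hy ((vswapAff_mem_cornerSimplex_iff l y).1 h))]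

/-- **Transposing two vertices inverts the class of a based simplicial sphere.** [folklore] -/
theorem toClass_hat_comp_swap [NeZero k] (g : C(stdSimplex ℝ (Fin (k + 1)), X)) (hg : IsBased x₀ g)
    {a b : Fin (k + 1)} (hab : a ≠ b) :
    (hat (g.comp (mapCM (Equiv.swap a b))) (hg.comp_mapCM _)).toClass = (hat g hg).toClass⁻¹ := by
  -- reduce to `a = 0 ∨ a = succ l`, `b = succ l'` etc.
  wlog hab' : a < b generalizing a b
  · have h := this hab.symm (lt_of_le_of_ne (not_lt.1 hab') hab.symm)
    simp only [Equiv.swap_comm b a] at h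
    exact h
  -- now `b ≠ 0`; write `b = succ l'`
  obtain ⟨l', rfl⟩ : ∃ l' : Fin k, b = l'.succ :=
    ⟨b.pred (Fin.pos_iff_ne_zero.1 (lt_of_le_of_lt (Fin.zero_le a) hab')),
      (Fin.succ_pred _ _).symm⟩
  rcases Fin.eq_zero_or_eq_succ a with rfl | ⟨l, rfl⟩
  · -- the vertex `0` and the vertex `l' + 1`: the affine involution `vswapAff l'`
    rw [hat_comp_mapCM_swap_zero g hg l', toClass_precompAff,
      signDet_of_neg (by rw [det_vswapAff]; norm_num), zpow_neg_one]
  · -- two vertices `l + 1 ≠ l' + 1`: the coordinate swap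
    have hll' : l ≠ l' := fun h => hab (by rw [h])
    have hdet : (swapMatrix l l').det ≠ 0 := by rw [det_swapMatrix hll']; norm_num
    have key : hat (g.comp (mapCM (Equiv.swap l.succ l'.succ))) (hg.comp_mapCM _) =
        precompLin (hat g hg) (swapMatrix l l') hdet := by
      refine ext fun y => ?_
      rw [precompLin_apply, swapMatrix_mulVec hll']
      by_cases hy : y ∈ cornerSimplex k
      · have hy' := (comp_swap_mem_cornerSimplex_iff (l := l) (l' := l') y).2 hy
        rw [hat_apply_of_mem _ _ hy, hat_apply_of_mem _ _ hy', ContinuousMap.comp_apply,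
          baryPt_comp_swap hy hy']
      · rw [hat_apply_of_not_mem _ _ hy,
          hat_apply_of_not_mem _ _ (fun h => hy ((comp_swap_mem_cornerSimplex_iff y).1 h))]
    rw [key, toClass_precompLin, signDet_of_neg (by rw [det_swapMatrix hll']; norm_num), zpow_neg_one]

/-- The sign of a permutation as an integer exponent `±1`. [folklore] -/
def permSign {n : ℕ} (σ : Perm (Fin n)) : ℤ := ((Perm.sign σ : ℤˣ) : ℤ)

/-- `permSign 1 = 1`. [folklore] -/
@[simp] theorem permSign_one {n : ℕ} : permSign (1 : Perm (Fin n)) = 1 := by simp [permSign]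

/-- `permSign` is multiplicative. [folklore] -/
theorem permSign_mul {n : ℕ} (σ τ : Perm (Fin n)) : permSign (σ * τ) = permSign σ * permSign τ := by
  simp [permSign]

/-- `permSign` of a transposition. [folklore] -/
theorem permSign_swap {n : ℕ} {a b : Fin n} (hab : a ≠ b) : permSign (Equiv.swap a b) = -1 := by
  simp [permSign, Perm.sign_swap hab]

/-- **Permuting the vertices multiplies the class by the sign of the permutation**:
`toClass (hat (g ∘ σ)) = toClass (hat g) ^ sign σ`. [folklore] -/
theorem toClass_hat_comp_mapCM [NeZero k] (σ : Perm (Fin (k + 1))) :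
    ∀ (g : C(stdSimplex ℝ (Fin (k + 1)), X)) (hg : IsBased x₀ g),
      (hat (g.comp (mapCM σ)) (hg.comp_mapCM σ)).toClass = (hat g hg).toClass ^ permSign σ := by
  induction σ using Perm.swap_induction_on with
  | one =>
    intro g hg
    rw [permSign_one, zpow_one]
    congr 1
    exact ext fun y => by
      show hat _ _ y = hat g hg y
      by_cases hy : y ∈ cornerSimplex k
      · rw [hat_apply_of_mem _ _ hy, hat_apply_of_mem _ _ hy, ContinuousMap.comp_apply]
        show g (mapCM 1 (baryPt y hy)) = g (baryPt y hy)
        rw [mapCM_one]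
      · rw [hat_apply_of_not_mem _ _ hy, hat_apply_of_not_mem _ _ hy]
  | swap_mul f a b hab ih =>
    intro g hg
    -- `g ∘ map (swap * f) = (g ∘ map swap) ∘ map f`
    have hcomp : g.comp (mapCM (Equiv.swap a b * f)) =
        (g.comp (mapCM (Equiv.swap a b))).comp (mapCM f) := by
      ext s
      simp only [ContinuousMap.comp_apply, mapCM_mul]
    have hbase := (hg.comp_mapCM (Equiv.swap a b)).comp_mapCM f
    have h1 : (hat (g.comp (mapCM (Equiv.swap a b * f))) (hg.comp_mapCM _)).toClass =
        (hat ((g.comp (mapCM (Equiv.swap a b))).comp (mapCM f)) hbase).toClass := by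
      congr 1
      exact ext fun y => by
        show hat _ _ y = hat _ _ y
        by_cases hy : y ∈ cornerSimplex k
        · rw [hat_apply_of_mem _ _ hy, hat_apply_of_mem _ _ hy, hcomp]
        · rw [hat_apply_of_not_mem _ _ hy, hat_apply_of_not_mem _ _ hy]
    rw [h1, ih _ (hg.comp_mapCM _), toClass_hat_comp_swap g hg hab, permSign_mul, permSign_swap hab,
      ← zpow_neg_one, ← zpow_mul, mul_comm]

end CSphere

end Literature.AlgebraicTopology.Homotopy

end
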